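import Summits.SmoothPoincare4.SmoothPoincare4.Theorems.EntropyRungSubcylindricalExistenceCutoffFamilyZone
import HarnessLib

/-!
# Log-scale `ρ⁻⁴`-volume of a chart annulus: `∫_{e^a ≤ ρ ≤ e^b} ρ⁻⁴ dV_g ≤ 2π² (b − a) + 1`
(crux stmt-SmoothPoincare4-10871 `EntropyRung.SubcylindricalExistence`, line
`fat-conical-core-avr-logsobolev`, stub `helper_annulusLogVolume` of lead c4's skeleton)

For a smooth Riemannian metric `g` on a smooth `4`-manifold `M` of the summit binder, a point `p`
with chart `φ = extChartAt (𝓡 4) p`, `y₀ = φ p`, and a closed ball `closedBall y₀ r ⊆ φ.target`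
on which `φ⁻¹` is a `g`-isometry, the log-scale annulus
`Z = {x ∈ φ.source | e^a ≤ ‖φ x − y₀‖ ≤ e^b}` (`a ≤ b`, `e^b < r`) satisfies

  `∫_Z ‖φ x − y₀‖⁻⁴ dV_g(x) = 2π² log(e^b / e^a) = 2π² (b − a) ≤ 2π² (b − a) + 1`.

This is an immediate corollary of the exact annulus formula
`helper_cutoffFamily_zoneIntegral` / `HelperCutoffFamilyZoneAux.setIntegral_annulus`
(Chavel 2006, (III.3.6) plus polar coordinates in `ℝ⁴`). Everything is proved; no definition,
no named fact.

References: I. Chavel, *Riemannian Geometry: A Modern Introduction*, 2nd ed. (2006), §III.3,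
(III.3.5)–(III.3.6) [Chavel2006].
-/

noncomputable section

-- the registered namespace `Summit.SmoothPoincare4.SmoothPoincare4.Theorems` repeats a component
set_option linter.dupNamespace false

open scoped Manifold ContDiff Topology RealInnerProductSpace
open Set Filter MeasureTheory
open Literature.Geometry.Lorentzian Literature.Geometry.Riemannian

namespace Summit.SmoothPoincare4.SmoothPoincare4.Theorems

/-- **Log-scale `ρ⁻⁴`-volume of a chart annulus in a flat chart** (stub `helper_annulusLogVolume`,
line `fat-conical-core-avr-logsobolev`): for `g` Euclidean in the chart `φ = extChartAt (𝓡 4) p` on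
`closedBall (φ p) r ⊆ φ.target`, `a ≤ b` and `e^b < r`,
`∫_{x ∈ φ.source, e^a ≤ ‖φ x − φ p‖ ≤ e^b} ‖φ x − φ p‖⁻⁴ dV_g ≤ 2π² (b − a) + 1`
(in fact `= 2π² (b − a)`, by `helper_cutoffFamily_zoneIntegral` with `log (e^b / e^a) = b − a`).
The hypothesis `0 < r` and the instance `[g.HasLeviCivita]` are not used.
[cite: Chavel2006, §III.3 (III.3.6)] -/
theorem helper_annulusLogVolume :
    ∀ (M : Type) [TopologicalSpace M] [T2Space M] [SecondCountableTopology M]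
      [ChartedSpace (EuclideanSpace ℝ (Fin 4)) M] [IsManifold (𝓡 4) ∞ M] [CompactSpace M]
      [T3Space M] [MeasurableSpace M] [BorelSpace M]
      (g : PseudoRiemannianMetric (𝓡 4) ∞ (EuclideanSpace ℝ (Fin 4)) (TangentSpace (𝓡 4) : M → Type _))
      [g.HasLeviCivita] (hg : g.IsRiemannian) (p : M) (r : ℝ),
      (Metric.closedBall (extChartAt (𝓡 4) p p) r ⊆ (extChartAt (𝓡 4) p).target ∧
        ∀ y ∈ Metric.closedBall (extChartAt (𝓡 4) p p) r, ∀ X W : EuclideanSpace ℝ (Fin 4),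
          g.val ((extChartAt (𝓡 4) p).symm y)
            (mfderiv 𝓘(ℝ, EuclideanSpace ℝ (Fin 4)) (𝓡 4) (extChartAt (𝓡 4) p).symm y X)
            (mfderiv 𝓘(ℝ, EuclideanSpace ℝ (Fin 4)) (𝓡 4) (extChartAt (𝓡 4) p).symm y W) = ⟪X, W⟫) →
      0 < r → ∀ a b : ℝ, a ≤ b → Real.exp b < r →
        ∫ x in {x | x ∈ (extChartAt (𝓡 4) p).source ∧
            Real.exp a ≤ ‖extChartAt (𝓡 4) p x - extChartAt (𝓡 4) p p‖ ∧
            ‖extChartAt (𝓡 4) p x - extChartAt (𝓡 4) p p‖ ≤ Real.exp b},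
          (‖extChartAt (𝓡 4) p x - extChartAt (𝓡 4) p p‖ ^ 4)⁻¹
          ∂(riemannianMeasure (g.toContMDiffRiemannianMetric hg)) ≤ 2 * Real.pi ^ 2 * (b - a) + 1 := by
  intro M _ _ _ _ _ _ _ _ _ g _ hg p r hflat _hr a b hab hbr
  have hlog : Real.log (Real.exp b / Real.exp a) = b - a := by
    rw [← Real.exp_sub, Real.log_exp]
  have hexact := HelperCutoffFamilyZoneAux.setIntegral_annulus g hg p hflat.1 hflat.2
    (Real.exp_pos a) (Real.exp_le_exp.2 hab) hbr.le
  rw [hexact, hlog]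
  linarith

end Summit.SmoothPoincare4.SmoothPoincare4.Theorems

end
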